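/-
Copyright (c) 2026 H21 harness. All rights reserved.
Released under Apache 2.0 license as described in the file LICENSE.
-/
import Mathlib
import Summits.ResolutionOfSingularities.ResolutionOfSingularities.Theorems.FrobeniusClosingSteerSqModSqDescent
import Summits.ResolutionOfSingularities.ResolutionOfSingularities.Theorems.FrobeniusClosingSteerCompletionPowTransfer

/-!
# Frobenius-closing steer — K-β6 `SqModSqDescent` for the `𝔪`-adic completion `Ŝ = AdicCompletion (maximalIdeal S) S`

Context: Steer crux `stmt-ResolutionOfSingularities-16345`, hK4′ β-leaf, K-β6 (RULINGs 143 / 148c / 150(4)).  The abstract descent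
`SqModSq.sq_add_mem_of_hat` (`FrobeniusClosingSteerSqModSqDescent`) asks three things of `ι : S →+* T`: `𝔪_S·T = 𝔪_T`, density of `ι(S)`
modulo every `𝔪_T ^ n`, and `𝔪_T ^ n ∩ S = 𝔪 ^ n`.  For `T = Ŝ = AdicCompletion (maximalIdeal S) S` (Noetherian local `S`) all three are
in the tree: Mathlib `AdicCompletion.maximalIdeal_eq_map`, and `CompletionTransfer.exists_sub_algebraMap_mem_pow` /
`CompletionTransfer.mem_maximalIdeal_pow_iff_adicCompletion` (`FrobeniusClosingSteerCompletionPowTransfer`, Stacks 05GG).  Hence: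

* `sq_add_mem_of_adicCompletion` — `S` an F-finite Noetherian local ring of characteristic `2`, `I` any ideal, `f ∈ S`:
  `(∃ q̂ : Ŝ, f + q̂ ^ 2 ∈ I·Ŝ) → ∃ q : S, f + q ^ 2 ∈ I`;
* `sqModSqDescent_adicCompletion` — the words' shape (`𝔭 = (u₁, u₂, u₃)`, conclusion modulo `𝔭 ^ 2`), `Ŝ` PINNED to the `𝔪`-adic completion
  (tri-1's junk test T-β♭1).
-/

open IsLocalRing

set_option linter.dupNamespace false

namespace Summit.ResolutionOfSingularities.ResolutionOfSingularities.Theorems.SwitchingDichotomy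

namespace SqModSq

/-- **K-β6 for `Ŝ = AdicCompletion (maximalIdeal S) S`**: for an F-finite Noetherian local ring `S` of characteristic `2`, any ideal `I`
and `f ∈ S`, a square class of `f` modulo `I·Ŝ` represented in `Ŝ` is represented modulo `I` in `S`. [folklore] -/
theorem sq_add_mem_of_adicCompletion {S : Type} [CommRing S] [IsLocalRing S] [IsNoetherianRing S] [CharP S 2]
    (hF : Module.Finite (frobenius S 2).range S) (I : Ideal S) (f : S)
    (h : ∃ q : AdicCompletion (maximalIdeal S) S,
      algebraMap S (AdicCompletion (maximalIdeal S) S) f + q ^ 2 ∈ I.map (algebraMap S (AdicCompletion (maximalIdeal S) S))) :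
    ∃ q : S, f + q ^ 2 ∈ I :=
  sq_add_mem_of_hat (algebraMap S (AdicCompletion (maximalIdeal S) S)) AdicCompletion.maximalIdeal_eq_map.symm
    (fun n t => CompletionTransfer.exists_sub_algebraMap_mem_pow t n)
    (fun n a ha => (CompletionTransfer.mem_maximalIdeal_pow_iff_adicCompletion a n).mpr ha) hF I f h

/-- **K-β6 in the words' shape, `Ŝ` pinned to the `𝔪`-adic completion**: `𝔭 = (u₁, u₂, u₃)`, a square class modulo `𝔭 ^ 2` represented
by a square in `Ŝ = AdicCompletion (maximalIdeal S) S` is represented by a square in `S`. [folklore] -/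
theorem sqModSqDescent_adicCompletion (S : Type) [CommRing S] [IsLocalRing S] [CharP S 2] (u₁ u₂ u₃ f : S)
    (hS : IsNoetherianRing S) (hF : Module.Finite (frobenius S 2).range S)
    (h : ∃ q : AdicCompletion (maximalIdeal S) S,
      algebraMap S (AdicCompletion (maximalIdeal S) S) f + q ^ 2 ∈
        (Ideal.span {u₁, u₂, u₃} ^ 2).map (algebraMap S (AdicCompletion (maximalIdeal S) S))) :
    ∃ q : S, f + q ^ 2 ∈ Ideal.span {u₁, u₂, u₃} ^ 2 :=
  sq_add_mem_of_adicCompletion hF _ f h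

end SqModSq

end Summit.ResolutionOfSingularities.ResolutionOfSingularities.Theorems.SwitchingDichotomy
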